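import Summits.PneNP.PneNP.Theorems.NegLimitedGapPMQuasipolyOfExp
import Literature.Computability.Complexity.KWProtocolFormula
import Literature.Computability.Complexity.CircuitSizeProofs
import Literature.Barriers.PneNP.MonotoneGapPerfectMatchingProofs
import HarnessLib

/-!
# Route NegLimited — corollaries of T5⁺ `GapPerfectMatchingExp` (line `r7-crosscut`, rung F-N1/p3, ROUND-7 §2 R7-S2/R7-S4)

Two routine consequences of the gap-robust exponential perfect-matching lower bound T5⁺
(`GapPerfectMatchingExp`, declared in `NegLimitedGapPMQuasipolyOfExp.lean`; item T5 =
`NegLimited.GapPerfectMatchingQuasipoly`, stmt-PneNP-19861; cell record HOME/pnp-ideate-p3/ROUND-7.md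
§2 (R7-S2, R7-S4), `Sketch-R7.lean` §D, `turnkey-R7/add_items.json`):

* `gapExp_implies_thm1` — **R7-S2**: T5⁺ implies CGRSS Theorem 1 as vendored in the tree, the named
  fact `Literature.Computability.Complexity.CavalarEtAl2026_perfectMatching`
  (`2^{n^{1/3-δ}} ≤ circuitSizeOver monotoneBasis (perfectMatchingFn n)` eventually): a smallest
  monotone circuit for `f_n` exists (`exists_monotone_circuit_perfectMatchingFn`,
  `exists_circuit_size_eq_circuitSizeOver`), accepts the graphs with a perfect matching and rejects
  every `2`-deficient graph once `n ≥ 2` (`perfectMatchingFn_eq_false_of_deficient`).  Landing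
  T5⁺ therefore turns the named fact into a theorem of the tree.
* `GapPMProtocolDepthPoly`, `gapExp_implies_protocolDepthPoly` — **R7-S4**, the Karchmer–Wigderson
  corollary (statement = `turnkey-R7/add_items.json` item `GapPMProtocolDepthPoly`, token-for-token):
  every deterministic protocol for the gapped Raz–Wigderson game `GPA_K` (Alice holds a graph with a
  perfect matching, Bob a `K`-deficient graph, they must name an edge of Alice's graph missing from
  Bob's) has depth `≥ m^{1/3-δ}` eventually, because a protocol of depth `D` correct on the rectangle
  `PM × Deficient_K` yields a monotone formula with `≤ 2^D - 1` gates separating the two sides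
  (`KWTree.exists_formula_of_rectangle`), to which T5⁺ applies.

Nothing here is asserted without proof; both results are implications from T5⁺ (hypothesis), to be
discharged by the registered stub `stub_gapPMExp` of the skeleton.
-/

set_option linter.dupNamespace false -- `Summit.PneNP.PneNP.…`: summit = sub-problem name (D-0017 single-conjunct layout)

namespace Summit.PneNP.PneNP.Theorems.NegLimitedGapPM

open Finset Filter
open Literature.Computability.Complexity
open Literature.Computability.Complexity.PerfectMatching
open Literature.Barriers.PneNP (perfectMatchingFn perfectMatchingFn_eq_true_iff perfectMatchingFn_permInput
  exists_monotone_circuit_perfectMatchingFn)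

variable {m : ℕ}

/-! ### Deficient graphs have no perfect matching -/

/-- The perfect matching of a permutation has `m` edges. -/
theorem card_permGraph (σ : Equiv.Perm (Fin m)) : #(permGraph σ) = m := by
  have h : permGraph σ = (univ : Finset (Fin m)).map
      ⟨fun i => (i, σ i), fun i j hij => (Prod.mk.inj hij).1⟩ := by
    ext e
    rw [mem_permGraph, Finset.mem_map]
    constructor
    · intro he
      exact ⟨e.1, mem_univ _, Prod.ext rfl he⟩
    · rintro ⟨i, -, rfl⟩
      rfl
  rw [h, card_map, card_univ, Fintype.card_fin]

/-- **A `K`-deficient graph with `K ≤ m`, `K ≥ 1`, has no perfect matching**: a perfect matching is a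
matching `D ⊆ x` with `m` edges, and `m + m/K ≤ m` forces `m < K`. -/
theorem perfectMatchingFn_eq_false_of_deficient {K : ℕ} (hK : 1 ≤ K) (hKm : K ≤ m) {x : Edge m → Bool}
    (hx : ∀ D : Finset (Edge m), IsMatching D → (∀ e ∈ D, x e = true) → D.card + m / K ≤ m) :
    perfectMatchingFn m x = false := by
  rw [Bool.eq_false_iff]
  intro h
  obtain ⟨σ, hσ⟩ := (perfectMatchingFn_eq_true_iff m x).1 h
  have hD := hx (permGraph σ) (isMatching_permGraph σ) fun e he => by
    rw [mem_permGraph] at he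
    have hee : e = (e.1, σ e.1) := Prod.ext rfl he.symm
    rw [hee]
    exact hσ e.1
  rw [card_permGraph] at hD
  have h0 : m / K = 0 := by
    have h' : m + m / K ≤ m + 0 := by rwa [Nat.add_zero]
    exact Nat.le_zero.1 (Nat.le_of_add_le_add_left h')
  have hpos : 0 < m / K := Nat.div_pos hKm hK
  rw [h0] at hpos
  exact lt_irrefl 0 hpos

/-! ### R7-S2: T5⁺ implies CGRSS Theorem 1 -/

/-- **R7-S2**: the gap-robust bound T5⁺ implies CGRSS Theorem 1 in the vendored form
`CavalarEtAl2026_perfectMatching` (`2^{n^{1/3-δ}} ≤ circuitSizeOver monotoneBasis (perfectMatchingFn n)`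
for all large `n`): apply T5⁺ with `K = 2` to a smallest monotone circuit computing `f_n`, which
accepts every graph with a perfect matching and, for `n ≥ 2`, rejects every `2`-deficient graph. -/
theorem gapExp_implies_thm1 : GapPerfectMatchingExp → CavalarEtAl2026_perfectMatching := by
  intro h δ hδ
  filter_upwards [h 2 le_rfl δ hδ, eventually_ge_atTop 2] with n hn hn2
  obtain ⟨C, hCB, hCf, hsize⟩ := exists_circuit_size_eq_circuitSizeOver
    (exists_monotone_circuit_perfectMatchingFn (m := n) (by omega))
  rw [← hsize]
  refine hn C hCB (fun x hx => by rw [hCf x]; exact hx) fun x hx => ?_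
  rw [hCf x]
  exact perfectMatchingFn_eq_false_of_deficient (by norm_num) hn2 hx

/-! ### R7-S4: the Karchmer–Wigderson corollary for the gapped Raz–Wigderson game -/

/-- **R7-S4 (`GapPMProtocolDepthPoly`)**: for every gap `K ≥ 2` and `δ > 0`, eventually in `m`, every
deterministic Karchmer–Wigderson protocol tree that, on every pair (graph with a perfect matching,
`K`-deficient graph), outputs an edge of the first graph missing from the second, has depth
`≥ m^{1/3-δ}` (statement of the support item proposed in `turnkey-R7/add_items.json`). -/
def GapPMProtocolDepthPoly : Prop :=
  ∀ K : ℕ, 2 ≤ K → ∀ δ : ℝ, 0 < δ → ∀ᶠ m : ℕ in Filter.atTop,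
    ∀ P : KWTree (Edge m),
      (∀ a b : Edge m → Bool, perfectMatchingFn m a = true →
        (∀ D : Finset (Edge m), IsMatching D → (∀ e ∈ D, b e = true) → D.card + m / K ≤ m) →
          a (P.run a b) = true ∧ b (P.run a b) = false) →
      (m : ℝ) ^ ((1 : ℝ) / 3 - δ) ≤ (P.depth : ℝ)

/-- **R7-S4 from T5⁺** (Karchmer–Wigderson, protocol ⟹ formula): a protocol of depth `D` correct on
the rectangle (perfect-matching graphs) × (`K`-deficient graphs) — both sides nonempty: the complete
graph and the empty graph — yields a monotone formula with `size + 1 ≤ 2^D` that is `1` on the first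
side and `0` on the second (`KWTree.exists_formula_of_rectangle`); T5⁺ bounds its size below by
`2^{m^{1/3-δ}}`, whence `m^{1/3-δ} < D`. -/
theorem gapExp_implies_protocolDepthPoly : GapPerfectMatchingExp → GapPMProtocolDepthPoly := by
  intro h K hK δ hδ
  filter_upwards [h K hK δ hδ] with m hm P hP
  -- the rectangle: perfect-matching graphs × `K`-deficient graphs, both nonempty
  set A : Set (Edge m → Bool) := {a | perfectMatchingFn m a = true} with hA
  set B : Set (Edge m → Bool) :=
    {b | ∀ D : Finset (Edge m), IsMatching D → (∀ e ∈ D, b e = true) → D.card + m / K ≤ m} with hB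
  have hAne : A.Nonempty := ⟨permInput 1, perfectMatchingFn_permInput 1⟩
  have hBne : B.Nonempty := by
    refine ⟨fun _ => false, fun D _ hD => ?_⟩
    have hD0 : D = ∅ := by
      rw [eq_empty_iff_forall_notMem]
      intro e he
      exact Bool.false_ne_true (hD e he)
    rw [hD0, card_empty, zero_add]
    exact Nat.div_le_self m K
  obtain ⟨C, hO, -, hT, hF, hs⟩ :=
    KWTree.exists_formula_of_rectangle P A B hAne hBne fun a ha b hb => hP a b ha hb
  -- T5⁺ applied to the formula
  have hsizeR : (2 : ℝ) ^ ((m : ℝ) ^ (1 / 3 - δ)) ≤ C.size :=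
    hm C hO (fun x hx => hT x hx) fun x hx => hF x hx
  -- `C.size < 2 ^ depth`
  have hlt : (C.size : ℝ) < (2 : ℝ) ^ (P.depth : ℝ) := by
    rw [Real.rpow_natCast]
    exact_mod_cast hs
  have key : (2 : ℝ) ^ ((m : ℝ) ^ ((1 : ℝ) / 3 - δ)) < (2 : ℝ) ^ (P.depth : ℝ) :=
    hsizeR.trans_lt hlt
  exact ((Real.rpow_lt_rpow_left_iff one_lt_two).1 key).le

end Summit.PneNP.PneNP.Theorems.NegLimitedGapPM
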